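import Literature.MathematicalPhysics.QuantumLattice.KohnLuttingerLindhardL2Vitali
import Mathlib.Topology.Instances.AddCircle.Defs
import HarnessLib

/-!
# The weighted polar Kohn–Luttinger kernel `w(θ) Γ_μ(γθ, γθ') w(θ')` is Hilbert–Schmidt and
`L²(dθdθ')`-continuous in the level (given the torus sublevel and shell-volume estimates)

Topic `Literature/MathematicalPhysics/QuantumLattice`; continues `KohnLuttingerLindhardL2Vitali`.
For the square lattice `ε = squareDispersion 1 0`, level `μ ∈ (-4, 0)`, polar point `γ_μ = fermiPolar μ`
and density of states `w_μ = fermiPolarDOS μ`, the pairing form in the channel problem is the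
quadratic form of the kernel `M_μ(θ, θ') = w_μ(θ) Γ_μ(γ_μθ, γ_μθ') w_μ(θ')` on `L²(dθ ⌞ (-π,π])`,
`Γ_μ(k,k') = U + U² χ₀(k + k'; μ)`. This file proves, GIVEN (TSL) and (SV):

* `eventually_forall_abs_sub_le_of_periodic`, `eventually_abs_fermiPolarDOS_sub_le`,
  `exists_eventually_le_fermiPolarDOS`, `exists_eventually_fermiPolarDOS_le` — the density of states
  is continuous in `μ` uniformly in `θ`, and locally uniformly pinched between positive constants;
* `integral_sq_eq_toReal_eLpNorm_sq` — `∫ f² = ‖f‖₂²` for `f ∈ L²`;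
* `memLp_klKernelPolar` — **(K1) `M_μ ∈ L²(dθdθ')`**;
* `tendsto_eLpNorm_klKernelPolar_sub`, `tendsto_integral_sq_klKernelPolar_sub` — **(K2)
  `∫ (M_μ - M_{μ₀})² dθdθ' → 0` as `μ → μ₀`**, for `μ₀` interior to a compact sub-band on which
  (TSL), (SV) hold uniformly.

Everything is proved; no definitions. [folklore]
-/

noncomputable section

open Real Set Filter MeasureTheory MeasureTheory.Measure
open scoped Topology ENNReal NNReal

namespace Literature.MathematicalPhysics.QuantumLattice

/-! ### Uniform-in-`θ` continuity of the density of states in `μ` -/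

/-- A function on `(-4, 0) × ℝ`, jointly continuous and `2π`-periodic in the second variable, is
continuous in the first variable UNIFORMLY in the second: for every `η > 0` and `μ₀ ∈ (-4, 0)`,
eventually in `μ`, `|f(μ, θ) - f(μ₀, θ)| ≤ η` for all `θ` (uniform continuity on the compact period
box). [folklore] -/
theorem eventually_forall_abs_sub_le_of_periodic {f : ℝ × ℝ → ℝ}
    (hf : ContinuousOn f (Ioo (-4 : ℝ) 0 ×ˢ univ))
    (hper : ∀ μ ∈ Ioo (-4 : ℝ) 0, ∀ θ, f (μ, θ + 2 * π) = f (μ, θ))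
    {μ₀ : ℝ} (hμ₀ : μ₀ ∈ Ioo (-4 : ℝ) 0) {η : ℝ} (hη : 0 < η) :
    ∀ᶠ μ in 𝓝 μ₀, ∀ θ, |f (μ, θ) - f (μ₀, θ)| ≤ η := by
  -- a compact box `[μ₀ - δ₀, μ₀ + δ₀] × [-π, π]` inside the domain
  obtain ⟨δ₀, hδ₀, hsub⟩ : ∃ δ₀ > 0, Icc (μ₀ - δ₀) (μ₀ + δ₀) ⊆ Ioo (-4 : ℝ) 0 := by
    have hp : 0 < min (μ₀ + 4) (-μ₀) := lt_min (by linarith [hμ₀.1]) (by linarith [hμ₀.2])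
    refine ⟨min (μ₀ + 4) (-μ₀) / 2, by positivity, fun μ hμ => ?_⟩
    have h1 : min (μ₀ + 4) (-μ₀) ≤ μ₀ + 4 := min_le_left _ _
    have h2 : min (μ₀ + 4) (-μ₀) ≤ -μ₀ := min_le_right _ _
    exact ⟨by linarith [hμ.1, hμ₀.1], by linarith [hμ.2, hμ₀.2]⟩
  set K : Set (ℝ × ℝ) := Icc (μ₀ - δ₀) (μ₀ + δ₀) ×ˢ Icc (-π) π with hK
  have hKc : IsCompact K := isCompact_Icc.prod isCompact_Icc
  have hfK : ContinuousOn f K := hf.mono (prod_mono hsub (subset_univ _))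
  have huc := hKc.uniformContinuousOn_of_continuous hfK
  rw [Metric.uniformContinuousOn_iff] at huc
  obtain ⟨δ₁, hδ₁, hclose⟩ := huc η hη
  have hball : ∀ᶠ μ in 𝓝 μ₀, dist μ μ₀ < min δ₀ δ₁ := Metric.eventually_nhds_iff.2 ⟨min δ₀ δ₁,
    lt_min hδ₀ hδ₁, fun μ h => h⟩
  filter_upwards [hball] with μ hμ θ
  have hμ0 : |μ - μ₀| < δ₀ := by rw [← Real.dist_eq]; exact hμ.trans_le (min_le_left _ _)
  have hμ1 : dist μ μ₀ < δ₁ := hμ.trans_le (min_le_right _ _)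
  -- reduce `θ` to the period `(-π, π]`
  set θ' := toIocMod Real.two_pi_pos (-π) θ with hθ'
  have hmem : θ' ∈ Icc (-π) π := by
    have h := toIocMod_mem_Ioc Real.two_pi_pos (-π) θ
    rw [← hθ'] at h
    exact ⟨h.1.le, by linarith [h.2]⟩
  have hμI : μ ∈ Icc (μ₀ - δ₀) (μ₀ + δ₀) := ⟨by linarith [(abs_lt.1 hμ0).1], by linarith [(abs_lt.1 hμ0).2]⟩
  have hμ₀I : μ₀ ∈ Icc (μ₀ - δ₀) (μ₀ + δ₀) := ⟨by linarith, by linarith⟩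
  have hperk : ∀ ν ∈ Ioo (-4 : ℝ) 0, ∀ (k : ℤ) (t : ℝ), f (ν, t + k * (2 * π)) = f (ν, t) := fun ν hν k t =>
    (show Function.Periodic (fun s => f (ν, s)) (2 * π) from fun s => hper ν hν s).int_mul k t
  have hred : ∀ ν ∈ Ioo (-4 : ℝ) 0, f (ν, θ) = f (ν, θ') := fun ν hν => by
    have : θ' = θ + (-(toIocDiv Real.two_pi_pos (-π) θ) : ℤ) * (2 * π) := by
      rw [hθ', toIocMod, zsmul_eq_mul]; push_cast; ring
    rw [this, hperk ν hν]
  rw [hred μ (hsub hμI), hred μ₀ (hsub hμ₀I)]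
  have hμK : (μ, θ') ∈ K := ⟨hμI, hmem⟩
  have hμ₀K : (μ₀, θ') ∈ K := ⟨hμ₀I, hmem⟩
  have hdist : dist (μ, θ') (μ₀, θ') < δ₁ := by
    rw [Prod.dist_eq, dist_self, max_eq_left dist_nonneg]; exact hμ1
  have := hclose _ hμK _ hμ₀K hdist
  rw [Real.dist_eq] at this
  exact this.le

/-- **The density of states is continuous in `μ` uniformly in `θ`**: eventually in `μ → μ₀`,
`|w_μ(θ) - w_μ₀(θ)| ≤ η` for all `θ`. [folklore] -/
theorem eventually_abs_fermiPolarDOS_sub_le {μ₀ : ℝ} (hμ₀ : μ₀ ∈ Ioo (-4 : ℝ) 0) {η : ℝ} (hη : 0 < η) :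
    ∀ᶠ μ in 𝓝 μ₀, ∀ θ, |fermiPolarDOS μ θ - fermiPolarDOS μ₀ θ| ≤ η := by
  have h := eventually_forall_abs_sub_le_of_periodic (f := fun p : ℝ × ℝ => fermiPolarDOS p.1 p.2)
    continuousOn_fermiPolarDOS_uncurry (fun μ hμ θ => fermiPolarDOS_add_two_pi hμ.1 hμ.2 θ) hμ₀ hη
  exact h

/-- **The density of states is locally uniformly bounded below**: there is `w₀ > 0` with
`w_μ(θ) ≥ w₀` for all `θ`, for all `μ` near `μ₀` (and at `μ₀`). [folklore] -/
theorem exists_eventually_le_fermiPolarDOS {μ₀ : ℝ} (hμ₀ : μ₀ ∈ Ioo (-4 : ℝ) 0) :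
    ∃ w₀ : ℝ, 0 < w₀ ∧ (∀ θ, w₀ ≤ fermiPolarDOS μ₀ θ) ∧ ∀ᶠ μ in 𝓝 μ₀, ∀ θ, w₀ ≤ fermiPolarDOS μ θ := by
  obtain ⟨m, M, hm0, hm⟩ := exists_bounds_fermiPolarDOS hμ₀.1 hμ₀.2
  refine ⟨m / 2, by linarith, fun θ => by linarith [(hm θ).1], ?_⟩
  filter_upwards [eventually_abs_fermiPolarDOS_sub_le hμ₀ (show (0 : ℝ) < m / 2 by linarith)] with μ hμ θ
  have h1 := (abs_le.1 (hμ θ)).1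
  have h2 := (hm θ).1
  linarith

/-- **The density of states is locally uniformly bounded above**: there is `w₁` with
`0 < w_μ(θ) ≤ w₁` for all `θ`, for all `μ` near `μ₀` (and at `μ₀`). [folklore] -/
theorem exists_eventually_fermiPolarDOS_le {μ₀ : ℝ} (hμ₀ : μ₀ ∈ Ioo (-4 : ℝ) 0) :
    ∃ w₁ : ℝ, 0 < w₁ ∧ (∀ θ, fermiPolarDOS μ₀ θ ≤ w₁) ∧ ∀ᶠ μ in 𝓝 μ₀, ∀ θ, fermiPolarDOS μ θ ≤ w₁ := by
  obtain ⟨m, M, hm0, hm⟩ := exists_bounds_fermiPolarDOS hμ₀.1 hμ₀.2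
  have hM : 0 < M := hm0.trans_le ((hm 0).1.trans (hm 0).2)
  refine ⟨M + 1, by linarith, fun θ => by linarith [(hm θ).2], ?_⟩
  filter_upwards [eventually_abs_fermiPolarDOS_sub_le hμ₀ one_pos] with μ hμ θ
  have h1 := (abs_le.1 (hμ θ)).2
  have h2 := (hm θ).2
  linarith

/-! ### `∫ f² = ‖f‖₂²` -/

/-- For a real `L²` function, `∫ f² = ‖f‖_{L²}²` (the Bochner integral of the square against the
`eLpNorm`). [folklore] -/
theorem integral_sq_eq_toReal_eLpNorm_sq {α : Type*} [MeasurableSpace α] {ν : Measure α} {f : α → ℝ}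
    (hf : MemLp f 2 ν) : ∫ x, f x ^ 2 ∂ν = (eLpNorm f 2 ν).toReal ^ 2 := by
  have key : Real.sqrt (∫ x, f x ^ 2 ∂ν) = (eLpNorm f 2 ν).toReal := by
    rw [hf.eLpNorm_eq_integral_rpow_norm (by norm_num) (by norm_num)]
    rw [ENNReal.toReal_ofReal (by positivity)]
    simp only [ENNReal.toReal_ofNat, Real.norm_eq_abs, Real.rpow_two, sq_abs]
    rw [Real.sqrt_eq_rpow]
    norm_num
  rw [← key, Real.sq_sqrt (integral_nonneg fun x => sq_nonneg _)]

/-! ### (K1) the weighted polar kernel is Hilbert–Schmidt -/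

section Band

variable {μ : ℝ} (hμ₁ : -4 < μ) (hμ₂ : μ < 0)
include hμ₁ hμ₂

/-- The Kohn–Luttinger kernel along the polar curve, `(θ,θ') ↦ Γ_μ(γθ, γθ') = U + U² χ₀(γθ + γθ'; μ)`,
is in `L²(dθdθ')` given (TSL) and (SV) at `μ`. [folklore] -/
theorem memLp_kohnLuttingerKernel_polar (U : ℝ) {C β Csh : ℝ} (hC : 0 ≤ C) (hβ0 : 0 < β) (hβ2 : β < 2)
    (hCsh : 0 ≤ Csh)
    (hTSL : ∀ (p : Momentum) (s : ℝ), 0 < s →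
      ((volume.restrict (Ioc (-π) π)).prod (volume.restrict (Ioc (-π) π)))
        {z : ℝ × ℝ | |squareDispersion 1 0 (p + (fermiPolar μ z.1 + fermiPolar μ z.2)) - μ| < s} ≤
        ENNReal.ofReal (C * s ^ β))
    (hSV : ∀ t : ℝ, 0 < t →
      volume (brillouinZone ∩ {p : Momentum | |squareDispersion 1 0 p - μ| < t}) ≤ ENNReal.ofReal (Csh * t)) :
    MemLp (fun z : ℝ × ℝ => kohnLuttingerKernel (squareDispersion 1 0) μ U (fermiPolar μ (Prod.fst z))
      (fermiPolar μ (Prod.snd z))) 2 ((volume.restrict (Ioc (-π) π)).prod (volume.restrict (Ioc (-π) π))) := by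
  have hχ := memLp_lindhardKernelPolar hμ₁ hμ₂ hC hβ0 hβ2 hCsh hTSL hSV
  have h := (memLp_const U (p := 2)
    (μ := (volume.restrict (Ioc (-π) π)).prod (volume.restrict (Ioc (-π) π)))).add (hχ.const_mul (U ^ 2))
  have hfun : (fun z : ℝ × ℝ => kohnLuttingerKernel (squareDispersion 1 0) μ U (fermiPolar μ (Prod.fst z))
      (fermiPolar μ (Prod.snd z))) = (fun _ : ℝ × ℝ => U) + fun z : ℝ × ℝ =>
        U ^ 2 * lindhardFunction (squareDispersion 1 0) μ (fermiPolar μ z.1 + fermiPolar μ z.2) := by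
    funext z
    simp only [Pi.add_apply, kohnLuttingerKernel]
  rw [hfun]
  exact h

/-- The weighted polar kernel is a.e.-strongly measurable. [folklore] -/
theorem aestronglyMeasurable_klKernelPolar (U : ℝ) :
    AEStronglyMeasurable (fun z : ℝ × ℝ => fermiPolarDOS μ (Prod.fst z) *
        kohnLuttingerKernel (squareDispersion 1 0) μ U (fermiPolar μ (Prod.fst z)) (fermiPolar μ (Prod.snd z)) *
        fermiPolarDOS μ (Prod.snd z))
      ((volume.restrict (Ioc (-π) π)).prod (volume.restrict (Ioc (-π) π))) := by
  have hw := continuous_fermiPolarDOS hμ₁ hμ₂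
  have hγ := continuous_fermiPolar hμ₁ hμ₂
  have hε : Measurable (squareDispersion 1 0) := by
    refine Continuous.measurable ?_
    unfold squareDispersion; fun_prop
  have hK := (measurable_kohnLuttingerKernel_uncurry hε μ U).comp
    ((hγ.measurable.comp measurable_fst).prodMk (hγ.measurable.comp measurable_snd))
  have h1 : Measurable fun z : ℝ × ℝ => fermiPolarDOS μ (Prod.fst z) := hw.measurable.comp measurable_fst
  have h2 : Measurable fun z : ℝ × ℝ => fermiPolarDOS μ (Prod.snd z) := hw.measurable.comp measurable_snd
  exact ((h1.mul hK).mul h2).aestronglyMeasurable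

/-- **(K1) The weighted polar Kohn–Luttinger kernel `w(θ) Γ_μ(γθ, γθ') w(θ')` is in `L²(dθdθ')`**
given (TSL) and (SV) at `μ` (`w` is bounded; `Γ_μ` along the curve is in `L²` by
`memLp_kohnLuttingerKernel_polar`). [folklore] -/
theorem memLp_klKernelPolar (U : ℝ) {C β Csh : ℝ} (hC : 0 ≤ C) (hβ0 : 0 < β) (hβ2 : β < 2) (hCsh : 0 ≤ Csh)
    (hTSL : ∀ (p : Momentum) (s : ℝ), 0 < s →
      ((volume.restrict (Ioc (-π) π)).prod (volume.restrict (Ioc (-π) π)))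
        {z : ℝ × ℝ | |squareDispersion 1 0 (p + (fermiPolar μ z.1 + fermiPolar μ z.2)) - μ| < s} ≤
        ENNReal.ofReal (C * s ^ β))
    (hSV : ∀ t : ℝ, 0 < t →
      volume (brillouinZone ∩ {p : Momentum | |squareDispersion 1 0 p - μ| < t}) ≤ ENNReal.ofReal (Csh * t)) :
    MemLp (fun z : ℝ × ℝ => fermiPolarDOS μ (Prod.fst z) *
        kohnLuttingerKernel (squareDispersion 1 0) μ U (fermiPolar μ (Prod.fst z)) (fermiPolar μ (Prod.snd z)) *
        fermiPolarDOS μ (Prod.snd z)) 2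
      ((volume.restrict (Ioc (-π) π)).prod (volume.restrict (Ioc (-π) π))) := by
  obtain ⟨m, M, hm0, hmM⟩ := exists_bounds_fermiPolarDOS hμ₁ hμ₂
  have hg := memLp_kohnLuttingerKernel_polar hμ₁ hμ₂ U hC hβ0 hβ2 hCsh hTSL hSV
  refine MemLp.of_le_mul hg (c := M * M) (aestronglyMeasurable_klKernelPolar hμ₁ hμ₂ U)
    (Eventually.of_forall fun z => ?_)
  have hw1 : |fermiPolarDOS μ z.1| ≤ M := by
    rw [abs_of_pos (hm0.trans_le (hmM z.1).1)]; exact (hmM z.1).2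
  have hw2 : |fermiPolarDOS μ z.2| ≤ M := by
    rw [abs_of_pos (hm0.trans_le (hmM z.2).1)]; exact (hmM z.2).2
  have hM0 : 0 ≤ M := hm0.le.trans ((hmM 0).1.trans (hmM 0).2)
  simp only [Real.norm_eq_abs, abs_mul]
  calc |fermiPolarDOS μ z.1| *
        |kohnLuttingerKernel (squareDispersion 1 0) μ U (fermiPolar μ z.1) (fermiPolar μ z.2)| *
        |fermiPolarDOS μ z.2|
      ≤ M * |kohnLuttingerKernel (squareDispersion 1 0) μ U (fermiPolar μ z.1) (fermiPolar μ z.2)| * M := by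
        gcongr
    _ = M * M * |kohnLuttingerKernel (squareDispersion 1 0) μ U (fermiPolar μ z.1) (fermiPolar μ z.2)| := by
        ring

end Band

/-! ### (K2) `L²(dθdθ')`-continuity of the weighted kernel in the level -/

/-- **(K2, `eLpNorm` form) `‖M_μ - M_{μ₀}‖_{L²(dθdθ')} → 0` as `μ → μ₀`** for `μ₀` interior to a
compact sub-band `[μ₁, μ₂] ⊂ (-4,0)` on which (TSL) and (SV) hold uniformly:
`M_μ - M_{μ₀} = (w_μ⊗w_μ) U²(χ_μ∘Σ_μ - χ_{μ₀}∘Σ_{μ₀}) + (w_μ⊗w_μ - w_{μ₀}⊗w_{μ₀}) Γ_{μ₀}`, the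
first term small in `L²` by (K2') and the local uniform bound on `w`, the second by the uniform
continuity of `w` in `μ` and `Γ_{μ₀} ∈ L²`. [folklore] -/
theorem tendsto_eLpNorm_klKernelPolar_sub {μ₁ μ₂ : ℝ} (hμ₁ : -4 < μ₁) (hμ₂ : μ₂ < 0) (U : ℝ)
    {C β Csh : ℝ} (hC : 0 ≤ C) (hβ0 : 0 < β) (hβ2 : β < 2) (hCsh : 0 ≤ Csh)
    (hTSL : ∀ μ ∈ Icc μ₁ μ₂, ∀ (p : Momentum) (s : ℝ), 0 < s →
      ((volume.restrict (Ioc (-π) π)).prod (volume.restrict (Ioc (-π) π)))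
        {z : ℝ × ℝ | |squareDispersion 1 0 (p + (fermiPolar μ z.1 + fermiPolar μ z.2)) - μ| < s} ≤
        ENNReal.ofReal (C * s ^ β))
    (hSV : ∀ μ ∈ Icc μ₁ μ₂, ∀ t : ℝ, 0 < t →
      volume (brillouinZone ∩ {p : Momentum | |squareDispersion 1 0 p - μ| < t}) ≤ ENNReal.ofReal (Csh * t))
    {μ₀ : ℝ} (hμ₀ : μ₀ ∈ Ioo μ₁ μ₂) :
    Tendsto (fun μ => eLpNorm (fun z : ℝ × ℝ =>
        fermiPolarDOS μ (Prod.fst z) *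
          kohnLuttingerKernel (squareDispersion 1 0) μ U (fermiPolar μ (Prod.fst z)) (fermiPolar μ (Prod.snd z)) *
          fermiPolarDOS μ (Prod.snd z) -
        fermiPolarDOS μ₀ (Prod.fst z) *
          kohnLuttingerKernel (squareDispersion 1 0) μ₀ U (fermiPolar μ₀ (Prod.fst z)) (fermiPolar μ₀ (Prod.snd z)) *
          fermiPolarDOS μ₀ (Prod.snd z)) 2
      ((volume.restrict (Ioc (-π) π)).prod (volume.restrict (Ioc (-π) π)))) (𝓝 μ₀) (𝓝 0) := by
  have hμ₀' : μ₀ ∈ Icc μ₁ μ₂ := Ioo_subset_Icc_self hμ₀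
  have hb0 : μ₀ ∈ Ioo (-4 : ℝ) 0 := ⟨hμ₁.trans_le hμ₀'.1, hμ₀'.2.trans_lt hμ₂⟩
  -- abbreviations (transparent `let`s; the goal is not rewritten)
  let ν : Measure (ℝ × ℝ) := (volume.restrict (Ioc (-π) π)).prod (volume.restrict (Ioc (-π) π))
  let w : ℝ → ℝ → ℝ := fun μ θ => fermiPolarDOS μ θ
  let G : ℝ → ℝ × ℝ → ℝ := fun μ z =>
    kohnLuttingerKernel (squareDispersion 1 0) μ U (fermiPolar μ (Prod.fst z)) (fermiPolar μ (Prod.snd z))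
  let X : ℝ → ℝ × ℝ → ℝ := fun μ z =>
    lindhardFunction (squareDispersion 1 0) μ (fermiPolar μ z.1 + fermiPolar μ z.2)
  -- the local uniform upper bound on `w`
  obtain ⟨W, hW0, hWμ₀, hWev⟩ := exists_eventually_fermiPolarDOS_le hb0
  -- `Γ_{μ₀} ∈ L²`
  have hG0 : MemLp (G μ₀) 2 ν :=
    memLp_kohnLuttingerKernel_polar hb0.1 hb0.2 U hC hβ0 hβ2 hCsh (hTSL μ₀ hμ₀') (hSV μ₀ hμ₀')
  obtain ⟨E, hE⟩ : ∃ E : ℝ, E = (eLpNorm (G μ₀) 2 ν).toReal := ⟨_, rfl⟩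
  have hEfin : eLpNorm (G μ₀) 2 ν ≠ ⊤ := hG0.eLpNorm_ne_top
  have hE0 : 0 ≤ E := by rw [hE]; exact ENNReal.toReal_nonneg
  -- (K2')
  have hK2' : Tendsto (fun μ => eLpNorm (fun z => X μ z - X μ₀ z) 2 ν) (𝓝 μ₀) (𝓝 0) :=
    tendsto_eLpNorm_lindhardKernelPolar_sub hμ₁ hμ₂ hC hβ0 hβ2 hCsh hTSL hSV hμ₀
  -- measurability of `G μ` for band levels
  have hGm : ∀ {μ : ℝ}, -4 < μ → μ < 0 → Measurable (G μ) := @fun μ' h1 h2 => by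
    have hε : Measurable (squareDispersion 1 0) := by
      refine Continuous.measurable ?_
      unfold squareDispersion; fun_prop
    have hγ := continuous_fermiPolar h1 h2
    have h := (measurable_kohnLuttingerKernel_uncurry hε μ' U).comp
      ((hγ.measurable.comp measurable_fst).prodMk (hγ.measurable.comp measurable_snd))
    exact h
  -- `G μ - G μ₀ = U² (X μ - X μ₀)`
  have hGX : ∀ μ z, G μ z - G μ₀ z = U ^ 2 * (X μ z - X μ₀ z) := fun μ z => by
    simp only [G, X, kohnLuttingerKernel]; ring
  -- the `e`-bound
  have hbound : ∀ e : ℝ, 0 < e → ∀ᶠ μ in 𝓝 μ₀,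
      eLpNorm (fun z => w μ z.1 * G μ z * w μ z.2 - w μ₀ z.1 * G μ₀ z * w μ₀ z.2) 2 ν ≤ ENNReal.ofReal e := by
    intro e he
    -- `η` for the second term
    obtain ⟨η, hη⟩ : ∃ η : ℝ, η = e / (4 * W * (E + 1)) := ⟨_, rfl⟩
    have hη0 : 0 < η := by rw [hη]; positivity
    have hηE : 2 * W * η * E ≤ e / 2 := by
      have hE1 : 0 < E + 1 := by linarith
      rw [hη, show 2 * W * (e / (4 * W * (E + 1))) * E = (e / 2) * (E / (E + 1)) by field_simp; ring]
      have : E / (E + 1) ≤ 1 := by rw [div_le_one hE1]; linarith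
      calc e / 2 * (E / (E + 1)) ≤ e / 2 * 1 := by gcongr
        _ = e / 2 := mul_one _
    -- first term eventually `< e/2`
    have hT1 : ∀ᶠ μ in 𝓝 μ₀, ENNReal.ofReal (W * W * U ^ 2) * eLpNorm (fun z => X μ z - X μ₀ z) 2 ν <
        ENNReal.ofReal (e / 2) := by
      have h := ENNReal.Tendsto.const_mul hK2' (Or.inr ENNReal.ofReal_ne_top) (a := ENNReal.ofReal (W * W * U ^ 2))
      rw [mul_zero] at h
      exact h.eventually (gt_mem_nhds (ENNReal.ofReal_pos.2 (half_pos he)))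
    have hband : ∀ᶠ μ in 𝓝 μ₀, μ ∈ Ioo (-4 : ℝ) 0 := isOpen_Ioo.mem_nhds hb0
    filter_upwards [hT1, hWev, eventually_abs_fermiPolarDOS_sub_le hb0 hη0, hband] with μ h1 hWμ hημ hμb
    have hwpos : ∀ θ, 0 < w μ θ := fun θ => fermiPolarDOS_pos hμb.1 hμb.2 θ
    have hw0pos : ∀ θ, 0 < w μ₀ θ := fun θ => fermiPolarDOS_pos hb0.1 hb0.2 θ
    -- pointwise decomposition
    have hdec : (fun z : ℝ × ℝ => w μ z.1 * G μ z * w μ z.2 - w μ₀ z.1 * G μ₀ z * w μ₀ z.2) =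
        (fun z => w μ z.1 * w μ z.2 * (G μ z - G μ₀ z)) +
          fun z => (w μ z.1 * w μ z.2 - w μ₀ z.1 * w μ₀ z.2) * G μ₀ z := by
      funext z; simp only [Pi.add_apply]; ring
    have hwc := continuous_fermiPolarDOS hμb.1 hμb.2
    have hwc0 := continuous_fermiPolarDOS hb0.1 hb0.2
    have hsm1 : AEStronglyMeasurable (fun z : ℝ × ℝ => w μ z.1 * w μ z.2 * (G μ z - G μ₀ z)) ν := by
      have hφ : Continuous fun z : ℝ × ℝ => w μ z.1 * w μ z.2 :=
        (hwc.comp continuous_fst).mul (hwc.comp continuous_snd)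
      exact (hφ.measurable.mul ((hGm hμb.1 hμb.2).sub (hGm hb0.1 hb0.2))).aestronglyMeasurable
    have hsm2 : AEStronglyMeasurable
        (fun z : ℝ × ℝ => (w μ z.1 * w μ z.2 - w μ₀ z.1 * w μ₀ z.2) * G μ₀ z) ν := by
      have hφ : Continuous fun z : ℝ × ℝ => w μ z.1 * w μ z.2 - w μ₀ z.1 * w μ₀ z.2 :=
        ((hwc.comp continuous_fst).mul (hwc.comp continuous_snd)).sub
          ((hwc0.comp continuous_fst).mul (hwc0.comp continuous_snd))
      exact (hφ.measurable.mul (hGm hb0.1 hb0.2)).aestronglyMeasurable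
    -- term 1
    have hle1 : eLpNorm (fun z : ℝ × ℝ => w μ z.1 * w μ z.2 * (G μ z - G μ₀ z)) 2 ν ≤
        ENNReal.ofReal (W * W * U ^ 2) * eLpNorm (fun z => X μ z - X μ₀ z) 2 ν := by
      refine eLpNorm_le_mul_eLpNorm_of_ae_le_mul (Eventually.of_forall fun z => ?_) 2
      rw [hGX, Real.norm_eq_abs, Real.norm_eq_abs, abs_mul, abs_mul, abs_mul,
        abs_of_pos (hwpos z.1), abs_of_pos (hwpos z.2), abs_of_nonneg (sq_nonneg U)]
      have := hWμ z.1; have := hWμ z.2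
      have hx : 0 ≤ |X μ z - X μ₀ z| := abs_nonneg _
      calc w μ z.1 * w μ z.2 * (U ^ 2 * |X μ z - X μ₀ z|)
          ≤ W * W * (U ^ 2 * |X μ z - X μ₀ z|) := by
            refine mul_le_mul_of_nonneg_right ?_ (by positivity)
            exact mul_le_mul (hWμ z.1) (hWμ z.2) (hwpos z.2).le hW0.le
        _ = W * W * U ^ 2 * |X μ z - X μ₀ z| := by ring
    -- term 2
    have hle2 : eLpNorm (fun z : ℝ × ℝ => (w μ z.1 * w μ z.2 - w μ₀ z.1 * w μ₀ z.2) * G μ₀ z) 2 ν ≤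
        ENNReal.ofReal (2 * W * η) * eLpNorm (G μ₀) 2 ν := by
      refine eLpNorm_le_mul_eLpNorm_of_ae_le_mul (Eventually.of_forall fun z => ?_) 2
      rw [Real.norm_eq_abs, Real.norm_eq_abs, abs_mul]
      refine mul_le_mul_of_nonneg_right ?_ (abs_nonneg _)
      have hsplit : w μ z.1 * w μ z.2 - w μ₀ z.1 * w μ₀ z.2 =
          w μ z.1 * (w μ z.2 - w μ₀ z.2) + (w μ z.1 - w μ₀ z.1) * w μ₀ z.2 := by ring
      rw [hsplit]
      refine (abs_add_le _ _).trans ?_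
      rw [abs_mul, abs_mul, abs_of_pos (hwpos z.1), abs_of_pos (hw0pos z.2)]
      have h1 := hημ z.1; have h2 := hημ z.2
      have hW1 := hWμ z.1; have hW2 := hWμ₀ z.2
      calc w μ z.1 * |w μ z.2 - w μ₀ z.2| + |w μ z.1 - w μ₀ z.1| * w μ₀ z.2
          ≤ W * η + η * W := add_le_add (mul_le_mul hW1 h2 (abs_nonneg _) hW0.le)
              (mul_le_mul h1 hW2 (hw0pos z.2).le hη0.le)
        _ = 2 * W * η := by ring
    -- assemble
    rw [hdec]
    refine (eLpNorm_add_le hsm1 hsm2 one_le_two).trans ?_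
    have h2' : ENNReal.ofReal (2 * W * η) * eLpNorm (G μ₀) 2 ν ≤ ENNReal.ofReal (e / 2) := by
      rw [← ENNReal.ofReal_toReal hEfin, ← hE, ← ENNReal.ofReal_mul (by positivity)]
      exact ENNReal.ofReal_le_ofReal hηE
    calc eLpNorm (fun z : ℝ × ℝ => w μ z.1 * w μ z.2 * (G μ z - G μ₀ z)) 2 ν +
          eLpNorm (fun z : ℝ × ℝ => (w μ z.1 * w μ z.2 - w μ₀ z.1 * w μ₀ z.2) * G μ₀ z) 2 ν
        ≤ ENNReal.ofReal (e / 2) + ENNReal.ofReal (e / 2) := add_le_add (hle1.trans h1.le) (hle2.trans h2')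
      _ = ENNReal.ofReal e := by rw [← ENNReal.ofReal_add (by positivity) (by positivity), add_halves]
  -- conclusion
  rw [ENNReal.tendsto_nhds_zero]
  intro ε hε
  by_cases hεtop : ε = ⊤
  · exact Eventually.of_forall fun μ => hεtop ▸ le_top
  have hεr : 0 < ε.toReal := ENNReal.toReal_pos hε.ne' hεtop
  filter_upwards [hbound ε.toReal hεr] with μ hμ
  rw [ENNReal.ofReal_toReal hεtop] at hμ
  exact hμ

/-- **(K2) `∫ (M_μ - M_{μ₀})² dθdθ' → 0` as `μ → μ₀`** (the Bochner-integral spelling of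
`tendsto_eLpNorm_klKernelPolar_sub`, valid because `M_μ ∈ L²` near `μ₀` by (K1)). [folklore] -/
theorem tendsto_integral_sq_klKernelPolar_sub {μ₁ μ₂ : ℝ} (hμ₁ : -4 < μ₁) (hμ₂ : μ₂ < 0) (U : ℝ)
    {C β Csh : ℝ} (hC : 0 ≤ C) (hβ0 : 0 < β) (hβ2 : β < 2) (hCsh : 0 ≤ Csh)
    (hTSL : ∀ μ ∈ Icc μ₁ μ₂, ∀ (p : Momentum) (s : ℝ), 0 < s →
      ((volume.restrict (Ioc (-π) π)).prod (volume.restrict (Ioc (-π) π)))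
        {z : ℝ × ℝ | |squareDispersion 1 0 (p + (fermiPolar μ z.1 + fermiPolar μ z.2)) - μ| < s} ≤
        ENNReal.ofReal (C * s ^ β))
    (hSV : ∀ μ ∈ Icc μ₁ μ₂, ∀ t : ℝ, 0 < t →
      volume (brillouinZone ∩ {p : Momentum | |squareDispersion 1 0 p - μ| < t}) ≤ ENNReal.ofReal (Csh * t))
    {μ₀ : ℝ} (hμ₀ : μ₀ ∈ Ioo μ₁ μ₂) :
    Tendsto (fun μ => ∫ z, (fermiPolarDOS μ (Prod.fst z) *
          kohnLuttingerKernel (squareDispersion 1 0) μ U (fermiPolar μ (Prod.fst z)) (fermiPolar μ (Prod.snd z)) *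
          fermiPolarDOS μ (Prod.snd z) -
        fermiPolarDOS μ₀ (Prod.fst z) *
          kohnLuttingerKernel (squareDispersion 1 0) μ₀ U (fermiPolar μ₀ (Prod.fst z)) (fermiPolar μ₀ (Prod.snd z)) *
          fermiPolarDOS μ₀ (Prod.snd z)) ^ 2
      ∂((volume.restrict (Ioc (-π) π)).prod (volume.restrict (Ioc (-π) π)))) (𝓝 μ₀) (𝓝 0) := by
  have hμ₀' : μ₀ ∈ Icc μ₁ μ₂ := Ioo_subset_Icc_self hμ₀
  have hb0 : μ₀ ∈ Ioo (-4 : ℝ) 0 := ⟨hμ₁.trans_le hμ₀'.1, hμ₀'.2.trans_lt hμ₂⟩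
  have hT := tendsto_eLpNorm_klKernelPolar_sub hμ₁ hμ₂ U hC hβ0 hβ2 hCsh hTSL hSV hμ₀
  -- `toReal² ∘ eLpNorm → 0`
  have hT' : Tendsto (fun μ => (eLpNorm (fun z : ℝ × ℝ =>
        fermiPolarDOS μ (Prod.fst z) *
          kohnLuttingerKernel (squareDispersion 1 0) μ U (fermiPolar μ (Prod.fst z)) (fermiPolar μ (Prod.snd z)) *
          fermiPolarDOS μ (Prod.snd z) -
        fermiPolarDOS μ₀ (Prod.fst z) *
          kohnLuttingerKernel (squareDispersion 1 0) μ₀ U (fermiPolar μ₀ (Prod.fst z)) (fermiPolar μ₀ (Prod.snd z)) *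
          fermiPolarDOS μ₀ (Prod.snd z)) 2
      ((volume.restrict (Ioc (-π) π)).prod (volume.restrict (Ioc (-π) π)))).toReal ^ 2) (𝓝 μ₀) (𝓝 0) := by
    have h := ((ENNReal.tendsto_toReal ENNReal.zero_ne_top).comp hT).pow 2
    rwa [ENNReal.toReal_zero, zero_pow two_ne_zero] at h
  -- the two spellings agree near `μ₀` (where both kernels are in `L²`)
  refine hT'.congr' ?_
  filter_upwards [Icc_mem_nhds hμ₀.1 hμ₀.2] with μ hμ
  have hb : μ ∈ Ioo (-4 : ℝ) 0 := ⟨hμ₁.trans_le hμ.1, hμ.2.trans_lt hμ₂⟩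
  have hM := memLp_klKernelPolar hb.1 hb.2 U hC hβ0 hβ2 hCsh (hTSL μ hμ) (hSV μ hμ)
  have hM0 := memLp_klKernelPolar hb0.1 hb0.2 U hC hβ0 hβ2 hCsh (hTSL μ₀ hμ₀') (hSV μ₀ hμ₀')
  exact (integral_sq_eq_toReal_eLpNorm_sq (hM.sub hM0)).symm

end Literature.MathematicalPhysics.QuantumLattice

end
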